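import Summits.QuantumFields.BalabanUV.T4Continuum.Support.ShellMeasureExpDuhamelDetSUN
import Summits.QuantumFields.BalabanUV.T4Continuum.Support.ShellMeasureExpDuhamelSUN

/-!
# `T4Continuum.ShellMeasureExpDuhamelDetChartSUN` — JUNCTION STEP 1 × STEP 2 of the (CH)₁ line: the determinant of
# THE chart operator `duhT v` of `ShellMeasureExpDuhamelSUN` — `det (duhT v) = ∏_{i<j} sinc²((θ_j−θ_i)/2)`,
# `= expJacSU v` off the non-regular cone, `∈ [0,1]`, `> 0` and `duhT v` invertible on `‖v‖ < π`
# (cell `pub-balaban`, sub-cell `t4`, spine estimate NE7c (node U5b); ROUND-2 crew `t4-ne7c-formalise-*`, row S3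
# «SM-L9 SU(N) chart» (c5: optional and last — `SU(2)` is the row's certified instance), the (CH)₁ line for `N ≥ 3`
# (GAPS G-ne7cL04-1; `CLAIMS.log` l.10111 STEP 1 (seat `leaf-08`), l.10254 STEP 2 (seat `leaf-09`), l.10221 (H)/(AF)
# (seat `leaf-10`)); seat `b2b-balaban-t4-ne7c-formalise-leaf-09` (gen 6); tree target
# `Summits/QuantumFields/BalabanUV/T4Continuum/Support/`; ADDITIVE — imports STEP 2's `ShellMeasureExpDuhamelDetSUN`
# and STEP 1's `ShellMeasureExpDuhamelSUN` and modifies nothing)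

HONEST FRAMING.  Finite four-torus programme, rung (B)+1 only — NOT infinite volume, NOT a mass gap, NOT the Clay
problem, NOT summit progress.  Nothing of [Balaban 1983–89] is mentioned or asserted; NE7c NOT proved and not touched
(spine PROVED 0/9); (CH)₁ for `N ≥ 3` (the displayed binder `hCH` of
`ShellMeasureRealizedSUN.slotAntiConcentration_realized_suN_expJac`) stays DISPLAYED until (H)/(AF) and the cone-nullity
land as well.  [folklore] — every theorem is STEP 2's headline APPLIED to STEP 1's operator with
`hT := ShellMeasureExpDuhamelSUN.genSU_duhT_eq_integral v` (the two files were written to this interface, `CLAIMS.log`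
l.10302); 0 sorry, 0 citations, no definition, no `def … : Prop`.

THE POINTS (all for `T_v := duhT v : E_N →L[ℝ] E_N`, coerced to `→ₗ[ℝ]` inside `LinearMap.det`).
* `det_duhT_eq_prod_sinc` — `det T_v = ∏_{i<j} sinc²((θ_j−θ_i)/2)` for EVERY unitary diagonalisation
  `H(v) = U·diag θ·U*` (RHS token-identical with S3 f4 `expJacSU_eq_prod_sinc`);
* `det_duhT_eq_expJacSU` / `abs_det_duhT_eq_expJacSU` — `det T_v = |det T_v| = expJacSU v` wherever
  `Re disc H(v) ≠ 0` (off the closed non-regular cone; there `expJacSU = 0` by definition while `det T_0 = 1`, so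
  this is the almost-everywhere identity the area-formula file (AF) consumes as its `hJ`, given the cone's nullity);
* `det_duhT_mem_Icc` — `0 ≤ det T_v ≤ 1`; `abs_det_duhT` — `|det T_v| = det T_v`;
* `det_duhT_pos`, `isUnit_duhT`, `duhT_injective` — on the open `π`-ball `det T_v > 0`, so `T_v` is invertible and
  injective: with STEP 1's `injective_chartDeriv_of_injective` the chart differential
  `h ↦ exp (genSU v) · genSU (T_v h)` is INJECTIVE for `‖v‖ < π` (`injective_chartDeriv`) — the hypothesis of the
  positive-codimension area formula `Literature.Analysis.Calculus.AreaFormulaHausdorff`;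
* `normDet_isometry_comp_duhT` — `normDet (J ∘ T_v) = ∏_{i<j} sinc²((θ_j−θ_i)/2)` for any real-linear isometry `J`.

WHAT THIS DOES NOT DO.  No measure theory: (H)/(AF) (Haar = normalised Hausdorff measure, area formula) and the
cone-nullity are separate files (seat `leaf-10`); the final assembly of `hCH` is not here.  NE7c NOT proved.
HONEST DEPENDENCY (cell, verbatim): continuum YM on T⁴ ⇐ BetaPertH ∧ nine spine estimates (0/9 proved);
BetaPertH ⇐ (D1) ∧ (D4) ∧ CAP+tail; G-an2-4 gates asym, D1 and NE2/3/4.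
(v1.1, gen 7, DOCFIX for the crew referee's DV-21: the HONEST DEPENDENCY sentence above added; STATUS NOTE: since v1
those separate files landed — (H) `ShellMeasureHaarHausdorffSUN`, cone nullity `ShellMeasureRegularConeSUN`, assembly
`ShellMeasureExpHaarAreaSUN.haar_restrict_expBallSU` (`S < π`, consuming this file's `det_duhT_eq_expJacSU` /
`det_duhT_pos`) and `ShellMeasureExpHaarClosedBallSUN.haar_restrict_expBallSU_le` (`S ≤ π`) — so `hCH` is a THEOREM for
every `N ≥ 1`; NE7c still NOT proved; no declaration changed — every theorem below is v1's byte for byte.)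
-/

noncomputable section

namespace Summit.QuantumFields.BalabanUV.T4Continuum.ShellMeasureExpDuhamelDetChartSUN

open Matrix Finset MeasureTheory
open Literature.MathematicalPhysics.QuantumFieldTheory.Balaban1983to89
open ShellMeasureVandermondeSUN ShellMeasureExpChartSUN ShellMeasureExpJacobianSUN ShellMeasureDuhamelHadamardSUN
open ShellMeasureExpDuhamelSUN ShellMeasureExpDuhamelDetSUN

variable {N : ℕ} {v : ChartSU N}

/-- **THE DETERMINANT OF THE CHART OPERATOR `duhT v`**: `∏_{i<j} sinc²((θ_j−θ_i)/2)` for every unitary diagonalisation of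
`H(v)`. [folklore] -/
theorem det_duhT_eq_prod_sinc {U : Matrix.unitaryGroup (Fin N) ℂ} {θ : Fin N → ℝ}
    (h : herm v = conjDiag U fun k => (θ k : ℂ)) :
    LinearMap.det (duhT v : ChartSU N →ₗ[ℝ] ChartSU N) =
      ∏ i : Fin N, ∏ j ∈ Ioi i, Real.sinc ((θ j - θ i) / 2) ^ 2 :=
  det_eq_prod_sinc h _ (genSU_duhT_eq_integral v)

/-- **`det (duhT v) = expJacSU v` OFF THE NON-REGULAR CONE** (`Re disc H(v) ≠ 0`). [folklore] -/
theorem det_duhT_eq_expJacSU (hreg : (disc (herm v)).re ≠ 0) :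
    LinearMap.det (duhT v : ChartSU N →ₗ[ℝ] ChartSU N) = expJacSU v :=
  det_eq_expJacSU hreg _ (genSU_duhT_eq_integral v)

/-- `0 ≤ det (duhT v) ≤ 1`. [folklore] -/
theorem det_duhT_mem_Icc (v : ChartSU N) :
    LinearMap.det (duhT v : ChartSU N →ₗ[ℝ] ChartSU N) ∈ Set.Icc (0 : ℝ) 1 :=
  det_mem_Icc _ (genSU_duhT_eq_integral v)

/-- `|det (duhT v)| = det (duhT v)`. [folklore] -/
theorem abs_det_duhT (v : ChartSU N) :
    |LinearMap.det (duhT v : ChartSU N →ₗ[ℝ] ChartSU N)| = LinearMap.det (duhT v : ChartSU N →ₗ[ℝ] ChartSU N) :=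
  abs_of_nonneg (det_duhT_mem_Icc v).1

/-- **`|det (duhT v)| = expJacSU v` OFF THE NON-REGULAR CONE** — the shape of (AF)'s almost-everywhere Jacobian
hypothesis `hJ` after its bridge `normDet (fderiv expM v) = |det (duhT v)|`. [folklore] -/
theorem abs_det_duhT_eq_expJacSU (hreg : (disc (herm v)).re ≠ 0) :
    |LinearMap.det (duhT v : ChartSU N →ₗ[ℝ] ChartSU N)| = expJacSU v := by
  rw [abs_det_duhT, det_duhT_eq_expJacSU hreg]

/-- **`0 < det (duhT v)` ON THE OPEN `π`-BALL.** [folklore] -/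
theorem det_duhT_pos (hv : ‖v‖ < Real.pi) : 0 < LinearMap.det (duhT v : ChartSU N →ₗ[ℝ] ChartSU N) :=
  det_pos_of_norm_lt_pi hv _ (genSU_duhT_eq_integral v)

/-- the chart operator is INVERTIBLE on the open `π`-ball. [folklore] -/
theorem isUnit_duhT (hv : ‖v‖ < Real.pi) : IsUnit (duhT v : ChartSU N →ₗ[ℝ] ChartSU N) :=
  (LinearMap.isUnit_iff_isUnit_det _).mpr (isUnit_iff_ne_zero.mpr (det_duhT_pos hv).ne')

/-- the chart operator is INJECTIVE on the open `π`-ball. [folklore] -/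
theorem duhT_injective (hv : ‖v‖ < Real.pi) : Function.Injective (duhT v) :=
  ((Module.End.isUnit_iff _).mp (isUnit_duhT hv)).1

/-- **THE CHART DIFFERENTIAL IS INJECTIVE ON THE OPEN `π`-BALL**: `h ↦ exp (genSU v) · genSU (duhT v h)` (the
derivative of `v ↦ ↑(expPtSU v)`, STEP 1's `hasFDerivAt_coe_expPtSU`) is injective for `‖v‖ < π` — the hypothesis of
the positive-codimension area formula. [folklore] -/
theorem injective_chartDeriv (hv : ‖v‖ < Real.pi) :
    Function.Injective fun h : ChartSU N => NormedSpace.exp (genSU v) * genSU (duhT v h) :=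
  injective_chartDeriv_of_injective (duhT_injective hv)

/-- **THE AREA-FORMULA JACOBIAN** of an isometric embedding after the chart operator:
`normDet (J ∘ duhT v) = ∏_{i<j} sinc²((θ_j−θ_i)/2)` for any real-linear isometry `J : E_N →ₗᵢ V`. [folklore] -/
theorem normDet_isometry_comp_duhT {V : Type*} [NormedAddCommGroup V] [InnerProductSpace ℝ V]
    (J : ChartSU N →ₗᵢ[ℝ] V) {U : Matrix.unitaryGroup (Fin N) ℂ} {θ : Fin N → ℝ}
    (h : herm v = conjDiag U fun k => (θ k : ℂ)) :
    (J.toLinearMap ∘ₗ (duhT v : ChartSU N →ₗ[ℝ] ChartSU N)).normDet =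
      ∏ i : Fin N, ∏ j ∈ Ioi i, Real.sinc ((θ j - θ i) / 2) ^ 2 :=
  normDet_isometry_comp J h _ (genSU_duhT_eq_integral v)

end Summit.QuantumFields.BalabanUV.T4Continuum.ShellMeasureExpDuhamelDetChartSUN

end
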